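import Literature.Computability.Complexity.CompetitiveInteractiveProofs
import Literature.Computability.Complexity.GoldwasserSipserRefereeBricks
import Literature.Computability.Complexity.OracleSubroutine
import Literature.Computability.Complexity.CoinCounting
import HarnessLib

/-!
# Competitive interactive proofs: `compIP ⊆ frIP` (Bellare–Goldwasser 1994, Lemma 4.3), proof

Topic `Computability/Complexity`, namespace `Literature.Computability.Complexity`; discharge of the
named fact `Literature.Computability.Complexity.compIP_subset_frIP` of
`CompetitiveInteractiveProofs.lean`:

* `compIP_subset_frIP_holds : compIP_subset_frIP`.

Bellare–Goldwasser [BG94, Lemma 4.3, p. 19 of the SIAM version]: "Suppose `L` has a competitive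
interactive proof system. Then it has a decider." Printed proof: "in probabilistic polynomial time we
can run both `P` and `V`. So given an oracle for `A`, the machine `D`, on input `x`, can sample the
space of conversations between `P^A` and `V` on input `x`, and accept if and only if the conversation
obtained is accepting. … `D` picks, uniformly at random, [coins] `R_P` and `R_V`. He now runs `P` and
`V` on common input `x`, using `R_P` as the coins for `P` and `R_V` as the coins for `V` … Oracle
queries made by `P` in this process are answered by `D` by way of its own oracle … Given any
particular oracle `A`, … the probability that [`D^A(x)`] is `1` equals the probability that `V`
accepts in its interaction with `P^A` on common input `x`. By the assumption that `(P, V)` was a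
competitive interactive proof for `L` it follows that `Pr[D^L(x) = 1] ≥ 2/3` in the case that
`x ∈ L`, and `Pr[D^A(x) = 1] ≤ 1/3` for all oracles `A` in the case that `x ∉ L`" — the last step
being soundness of `V` against the prover `P^A` (with ITS coins fixed) for every `A`.

## The formalization (transcript model of `Oracle.lean`, verifier model of `InteractiveProofs.lean`)

The decider is assembled exactly as printed, in two layers.

1. **`V` run against a prover given as an oracle** (`CompIPDecider.outerAlg V c : OracleAlg Bool`).
   Input `w = ⟨x, t⟩` with `t = R_V R_P` (`r = t↾ℓ`, `ℓ = coins |x|`, the verifier's coins; `s = t⇂ℓ`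
   the prover's); the ORACLE of this layer is the prover's next-message function `f` (a competitive
   prover with coins `s` answers the history `msgs` by `f ⟨x, ⟨s, enc msgs⟩⟩`,
   `competitiveStrategy f x s`). After `j` answers the algorithm replays the verifier on `r` against
   the recorded answers (`CompIPDecider.replayT`), and either asks the prover for its next message
   (query `⟨x, ⟨s, enc (a₁ … a_{2j+1})⟩⟩`, while `2j + 1 < k = |x|^c`) or outputs the verdict of `V`.
   Its run against `f` outputs `[V accepts (x, r) against competitiveStrategy f x s]` within
   `k/2 + 1` rounds (`CompIPDecider.run_outerAlg`), with polynomially long queries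
   (`CompIPDecider.length_le_of_mem_queries`). Its step function is written in the tree's algebra of
   `FP` bricks (`BrickAlgebra.lean`, `FoldBricks.lean`, and the replay operation `GSRef.replayOp` /
   message brick `GSRef.msgF` of `GoldwasserSipserRefereeBricks.lean`), whence
   `CompIPDecider.outerAlg_isPolyTime` — "in probabilistic polynomial time we can run … `V`".
2. **The prover's oracle machine as a clocked subroutine.** The honest prover is
   `M ∈ FP^L = FPRel (Oracle.ofLanguage L)`, computed by an oracle algorithm `R` within `qR |u|`
   rounds under oracle `L`. `OracleAlg.exists_polyTime_subroutine` (`OracleSubroutine.lean`: "answer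
   each query of the first procedure by running the second", with a time-out) composes the two
   layers into ONE polynomial-time oracle algorithm `C` whose oracle is `D`'s oracle: under oracle `O`
   it behaves as layer 1 against the prover `f_O = OracleAlg.subAnswer R qR [] O` ("oracle queries
   made by `P` … are answered by `D` by way of its own oracle"); `f_L = M` (the honest interaction),
   and for ANY `A`, `f_A` is SOME prover strategy (for each fixed `s`), so soundness of `V` applies.
3. **Probabilities.** `D = ⟨C, coins + q, ·⟩` reads ONE uniform string `t = R_V R_P`; completeness is
   the completeness clause of `IsCompetitiveIP` verbatim, soundness is the average over `R_P` of the
   soundness bound for the provers `competitiveStrategy f_A x s`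
   (`CompIPDecider.uniformProb_split_le`: a bound on every section of an event on `{0,1}^{a+b}` bounds
   the event).

All proved; no named fact is introduced (D-0026).

## References

* M. Bellare, S. Goldwasser, *The complexity of decision versus search*, SIAM J. Comput. 23 (1994)
  97–119, §3 Def. 3.1 (deciders; "`L` has a decider if and only if it is in function-restricted
  IP"), §4.2 Def. 4.2, §4.3 Lemma 4.3 (`compIP ⊆ frIP`) and its proof [BellareGoldwasser1994].
* S. Arora, B. Barak, *Computational Complexity: A Modern Approach*, CUP 2009, Def. 8.6
  (verifiers), §3.4 (oracle machines), §1.3 (closure of polynomial time under composition and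
  bounded loops) [AroraBarakCC2009].
* R. E. Ladner, N. A. Lynch, A. L. Selman, *A comparison of polynomial time reducibilities*,
  Theoret. Comput. Sci. 1 (1975), §2 (composing oracle procedures) [LadnerLynchSelman1975].
-/

noncomputable section

namespace Literature.Computability.Complexity

open _root_.Computability Polynomial Brick Plumb OracleCompose HashBricks Kannan PRelSigma
open Literature.Computability.Cryptography (OracleAdversary)

namespace CompIPDecider

/-! ### Small list facts -/

/-- `getD` on an extension by one item, below the old length. [folklore] -/
theorem getD_append_of_lt {α : Type} (l : List α) (a d : α) {i : ℕ} (hi : i < l.length) :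
    (l ++ [a]).getD i d = l.getD i d := by
  rw [List.getD_eq_getElem?_getD, List.getD_eq_getElem?_getD, List.getElem?_append_left hi]

/-- `getD` on an extension by one item, at the old length. [folklore] -/
theorem getD_append_length {α : Type} (l : List α) (a d : α) : (l ++ [a]).getD l.length d = a := by
  rw [List.getD_eq_getElem?_getD, List.getElem?_concat_length]
  rfl

variable (V : IPVerifier) (c : ℕ)

/-! ### The replay of the verifier against recorded prover answers -/

/-- **The replay model**: `i` rounds of "the verifier's message (coins `r`, message length `m`),
then the recorded prover answer `ans[i]` normalised to length `m`" — the `2i`-message history the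
decider has reconstructed after receiving `i` answers from the prover.
[cite: BellareGoldwasser1994, Lemma 4.3 (proof: "He would then run V … to get the response, and so on")] -/
def replayT (x r : List Bool) (m : ℕ) (ans : List (List Bool)) : ℕ → List (List Bool)
  | 0 => []
  | i + 1 => replayT x r m ans i ++
      [V.vmsg x m r (replayT x r m ans i), (ans.getD i []).takeD m false]

/-- The replay of `i` rounds has `2i` messages. [folklore] -/
@[simp] theorem length_replayT (x r : List Bool) (m : ℕ) (ans : List (List Bool)) :
    ∀ i : ℕ, (replayT V x r m ans i).length = 2 * i
  | 0 => rfl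
  | i + 1 => by
    rw [replayT, List.length_append, length_replayT x r m ans i]
    simp
    ring

/-- The replay of `i` rounds only reads the first `i` recorded answers. [folklore] -/
theorem replayT_congr (x r : List Bool) (m : ℕ) {ans ans' : List (List Bool)} :
    ∀ {i : ℕ}, (∀ i' < i, ans.getD i' [] = ans'.getD i' []) →
      replayT V x r m ans i = replayT V x r m ans' i
  | 0, _ => rfl
  | i + 1, h => by
    rw [replayT, replayT, replayT_congr x r m (i := i) fun i' hi' => h i' (by omega), h i (by omega)]

/-! ### The outer oracle algorithm: the verifier run against a prover given as an oracle -/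

/-- The verifier's coins `r = t↾ℓ` read off the decider's input `w = ⟨x, t⟩`. [folklore] -/
def rOf (w : List Bool) : List Bool := (sndF w).take (V.coins.eval (fstF w).length)

/-- The prover's coins `s = t⇂ℓ` read off the decider's input `w = ⟨x, t⟩`. [folklore] -/
def sOf (w : List Bool) : List Bool := (sndF w).drop (V.coins.eval (fstF w).length)

/-- The message length `m = msgLen |x|` read off `w = ⟨x, t⟩`. [folklore] -/
def mOf (w : List Bool) : ℕ := V.msgLen.eval (fstF w).length

/-- The history reconstructed from the answers received so far. [folklore] -/
def curT (w : List Bool) (ans : List (List Bool)) : List (List Bool) :=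
  replayT V (fstF w) (rOf V w) (mOf V w) ans ans.length

/-- The verifier's next message after the reconstructed history. [folklore] -/
def nextA (w : List Bool) (ans : List (List Bool)) : List Bool :=
  V.vmsg (fstF w) (mOf V w) (rOf V w) (curT V w ans)

/-- **The step of the outer algorithm** on input `w = ⟨x, t⟩` after the prover answers `ans`
(`j = |ans|`, `k = |x|^c` messages in all): while `2j + 1 < k`, ask the prover (the ORACLE of this
layer) for its next message, the query being its view `⟨x, ⟨s, enc (a₁, …, a_{2j+1})⟩⟩`; otherwise
output the verifier's verdict on the completed transcript (with a last verifier message if `k` is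
odd). [cite: BellareGoldwasser1994, Lemma 4.3 (proof)] -/
def outerStep (w : List Bool) (ans : List (List Bool)) : List Bool ⊕ Bool :=
  if 2 * ans.length + 1 < (fstF w).length ^ c then
    Sum.inl (boolPair (fstF w) (boolPair (sOf V w) (encMoves (curT V w ans ++ [nextA V w ans]))))
  else
    Sum.inr (V.verdict.boolIndicator (IPVerifier.view (fstF w) (rOf V w)
      (if 2 * ans.length < (fstF w).length ^ c then curT V w ans ++ [nextA V w ans]
        else curT V w ans)))

/-- **The outer oracle algorithm** `V` run, on `w = ⟨x, R_V R_P⟩`, against a prover strategy given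
as an oracle. [cite: BellareGoldwasser1994, Lemma 4.3 (proof)] -/
def outerAlg : OracleAlg Bool where
  step w ans := outerStep V c w ans

/-! ### The step function of the outer algorithm as an `FP` brick

Argument `z = ⟨w, enc ans⟩ = ⟨⟨x, t⟩, ⟨1ʲ, encList ans⟩⟩`. -/

/-- `t` (`x` itself is `Boards.xF = fstF ∘ nthF 0` of `ArthurMerlinBoards.lean`). [folklore] -/
def tF : List Bool → List Bool := sndF ∘ fstF
/-- `1ʲ`. [folklore] -/
def jU : List Bool → List Bool := fstF ∘ sndF
/-- `encList ans`. [folklore] -/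
def ansE : List Bool → List Bool := sndF ∘ sndF
/-- `1^ℓ`, `ℓ = coins |x|`. [folklore] -/
def ellF : List Bool → List Bool := GSRef.ellU V ∘ Boards.xF
/-- `r = t↾ℓ`. [folklore] -/
def rF : List Bool → List Bool := takeFn ∘ fanoutFn (ellF V) tF
/-- `s = t⇂ℓ`. [folklore] -/
def sF : List Bool → List Bool := dropFn ∘ fanoutFn (ellF V) tF
/-- The context of the replay fold: `⟨x, ⟨r, encList ans⟩⟩`. [folklore] -/
def ctxF : List Bool → List Bool := fanoutFn Boards.xF (fanoutFn (rF V) ansE)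

/-- **The replay piece** `⟨⟨x, ⟨r, encList ans⟩⟩, 1ⁱ⟩ ↦ ⟨x, ⟨r, ans[i] 0^m⟩⟩` (the `i`-th recorded
answer, padded so that the truncation `take m` of `GSRef.replayOp` is `takeD m · false`). [folklore] -/
def pieceF : List Bool → List Bool :=
  fanoutFn (nthF 0 ∘ fstF) (fanoutFn (nthF 1 ∘ fstF)
    (appF ∘ fanoutFn (nthItemFn ∘ fanoutFn sndF (sndPow 1 ∘ fstF))
      (zerosFn ∘ GSRef.emU V ∘ nthF 0 ∘ fstF)))

/-- **The replay**: `j` rounds of `GSRef.replayOp` folding in the pieces — `⟨1^{2j}, encList T_j⟩`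
(`ε` for `j = 0`). [cite: BellareGoldwasser1994, Lemma 4.3 (proof)] -/
def replayF : List Bool → List Bool := runFold (GSRef.replayOp V) (pieceF V) (ctxF V) jU

/-- `1^{2j}`. [folklore] -/
def accU : List Bool → List Bool := fstF ∘ replayF V
/-- `encList T_j`. [folklore] -/
def accE : List Bool → List Bool := sndF ∘ replayF V
/-- The verifier's view `⟨x, ⟨r, enc T_j⟩⟩`. [folklore] -/
def viewF : List Bool → List Bool := fanoutFn Boards.xF (fanoutFn (rF V) (fanoutFn (accU V) (accE V)))
/-- The verifier's next message `a`. [folklore] -/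
def msgNextF : List Bool → List Bool := GSRef.msgF V ∘ fanoutFn Boards.xF (viewF V)
/-- `1^{2j+1}`. [folklore] -/
def extU : List Bool → List Bool := List.cons true ∘ accU V
/-- `encList (T_j a)`. [folklore] -/
def extE : List Bool → List Bool := appF ∘ fanoutFn (accE V) (fanoutFn (msgNextF V) fun _ => [])
/-- The query `⟨x, ⟨s, enc (T_j a)⟩⟩`. [folklore] -/
def qryF : List Bool → List Bool := fanoutFn Boards.xF (fanoutFn (sF V) (fanoutFn (extU V) (extE V)))
/-- `1^k`, `k = |x|^c`. [folklore] -/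
def kU : List Bool → List Bool := polyFn (X ^ c) ∘ Boards.xF
/-- The guard `[2j + 1 < k]`. [folklore] -/
def goOnF : List Bool → List Bool :=
  ltLenF ∘ fanoutFn (List.cons true ∘ appF ∘ fanoutFn jU jU) (kU c)
/-- The parity test `[2j < k]`. [folklore] -/
def oddF : List Bool → List Bool := ltLenF ∘ fanoutFn (appF ∘ fanoutFn jU jU) (kU c)
/-- The final view of the verifier. [folklore] -/
def finViewF : List Bool → List Bool :=
  fanoutFn Boards.xF (fanoutFn (rF V)
    (iteFn (oddF c) (fanoutFn (extU V) (extE V)) (fanoutFn (accU V) (accE V))))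
/-- The verdict bit. [folklore] -/
def verdF : List Bool → List Bool :=
  (fun v => encodeBool (V.verdict.boolIndicator v)) ∘ finViewF V c
/-- **The step function of the outer algorithm as a string map** (query code `0 · query`, output
code `1 · bit`). [cite: BellareGoldwasser1994, Lemma 4.3 (proof)] -/
def stepS : List Bool → List Bool :=
  iteFn (goOnF c) (List.cons false ∘ qryF V) (List.cons true ∘ verdF V c)

/-! #### Membership in `FP` -/

/-- `tF ∈ FP`. [folklore] -/
theorem tF_mem_FP : tF ∈ FP := comp_mem_FP sndF_mem_FP fstF_mem_FP
/-- `jU ∈ FP`. [folklore] -/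
theorem jU_mem_FP : jU ∈ FP := comp_mem_FP fstF_mem_FP sndF_mem_FP
/-- `ansE ∈ FP`. [folklore] -/
theorem ansE_mem_FP : ansE ∈ FP := comp_mem_FP sndF_mem_FP sndF_mem_FP
/-- `ellF ∈ FP`. [folklore] -/
theorem ellF_mem_FP : ellF V ∈ FP := comp_mem_FP (polyFn_mem_FP _) Boards.xF_mem_FP
/-- `rF ∈ FP`. [folklore] -/
theorem rF_mem_FP : rF V ∈ FP := comp_mem_FP takeFn_mem_FP (fanoutFn_mem_FP (ellF_mem_FP V) tF_mem_FP)
/-- `sF ∈ FP`. [folklore] -/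
theorem sF_mem_FP : sF V ∈ FP := comp_mem_FP dropFn_mem_FP (fanoutFn_mem_FP (ellF_mem_FP V) tF_mem_FP)
/-- `ctxF ∈ FP`. [folklore] -/
theorem ctxF_mem_FP : ctxF V ∈ FP :=
  fanoutFn_mem_FP Boards.xF_mem_FP (fanoutFn_mem_FP (rF_mem_FP V) ansE_mem_FP)
/-- `pieceF ∈ FP`. [folklore] -/
theorem pieceF_mem_FP : pieceF V ∈ FP :=
  fanoutFn_mem_FP (comp_mem_FP (nthF_mem_FP 0) fstF_mem_FP)
    (fanoutFn_mem_FP (comp_mem_FP (nthF_mem_FP 1) fstF_mem_FP)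
      (comp_mem_FP appF_mem_FP (fanoutFn_mem_FP
        (comp_mem_FP nthItemFn_mem_FP (fanoutFn_mem_FP sndF_mem_FP (comp_mem_FP (sndPow_mem_FP 1) fstF_mem_FP)))
        (comp_mem_FP zerosFn_mem_FP (comp_mem_FP (polyFn_mem_FP _)
          (comp_mem_FP (nthF_mem_FP 0) fstF_mem_FP))))))

/-- **Growth of the replay piece**: `|pieceF z| ≤ 5 |fstF z| + 4 + msgLen |fstF z|`. [folklore] -/
theorem length_pieceF_le (z : List Bool) :
    (pieceF V z).length ≤ (5 * X + 4 + V.msgLen).eval (fstF z).length := by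
  have h0 := length_nthF_le 0 (fstF z)
  have h1 := length_nthF_le 1 (fstF z)
  have h2 : (nthItemFn (fanoutFn sndF (sndPow 1 ∘ fstF) z)).length ≤ (fstF z).length := by
    rw [fanoutFn_apply]
    exact (GSRef.length_nthItemFn_boolPair_le _ _).trans (length_sndPow_le 1 _)
  have h3 : V.msgLen.eval (nthF 0 (fstF z)).length ≤ V.msgLen.eval (fstF z).length :=
    TM2Iter.eval_mono _ h0
  rw [pieceF, length_fanoutFn, length_fanoutFn]
  simp only [Function.comp_apply, appF_boolPair, fanoutFn_apply, List.length_append, zerosFn_apply,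
    List.length_replicate, GSRef.emU_apply, List.length_replicate, eval_add, eval_mul, eval_ofNat,
    eval_X] at h2 ⊢
  omega

/-- `replayF ∈ FP` for a polynomial-time verifier: a fold with pieces of polynomial size
(`Brick.runFold_mem_FP`). [cite: AroraBarakCC2009, §1.3 (bounded loops)] -/
theorem replayF_mem_FP (hV : V.IsPolyTime) : replayF V ∈ FP :=
  runFold_mem_FP (GSRef.replayOp_mem_FP V hV) (4 * V.msgLen + 10) (GSRef.length_replayOp_le V)
    (pieceF_mem_FP V) (5 * X + 4 + V.msgLen) (length_pieceF_le V) (ctxF_mem_FP V) jU_mem_FP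
/-- `accU ∈ FP`. [folklore] -/
theorem accU_mem_FP (hV : V.IsPolyTime) : accU V ∈ FP := comp_mem_FP fstF_mem_FP (replayF_mem_FP V hV)
/-- `accE ∈ FP`. [folklore] -/
theorem accE_mem_FP (hV : V.IsPolyTime) : accE V ∈ FP := comp_mem_FP sndF_mem_FP (replayF_mem_FP V hV)
/-- `viewF ∈ FP`. [folklore] -/
theorem viewF_mem_FP (hV : V.IsPolyTime) : viewF V ∈ FP :=
  fanoutFn_mem_FP Boards.xF_mem_FP (fanoutFn_mem_FP (rF_mem_FP V)
    (fanoutFn_mem_FP (accU_mem_FP V hV) (accE_mem_FP V hV)))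
/-- `msgNextF ∈ FP`. [folklore] -/
theorem msgNextF_mem_FP (hV : V.IsPolyTime) : msgNextF V ∈ FP :=
  comp_mem_FP (GSRef.msgF_mem_FP V hV) (fanoutFn_mem_FP Boards.xF_mem_FP (viewF_mem_FP V hV))
/-- `extU ∈ FP`. [folklore] -/
theorem extU_mem_FP (hV : V.IsPolyTime) : extU V ∈ FP := comp_mem_FP (cons_mem_FP true) (accU_mem_FP V hV)
/-- `extE ∈ FP`. [folklore] -/
theorem extE_mem_FP (hV : V.IsPolyTime) : extE V ∈ FP :=
  comp_mem_FP appF_mem_FP (fanoutFn_mem_FP (accE_mem_FP V hV)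
    (fanoutFn_mem_FP (msgNextF_mem_FP V hV) (const_mem_FP _)))
/-- `qryF ∈ FP`. [folklore] -/
theorem qryF_mem_FP (hV : V.IsPolyTime) : qryF V ∈ FP :=
  fanoutFn_mem_FP Boards.xF_mem_FP (fanoutFn_mem_FP (sF_mem_FP V)
    (fanoutFn_mem_FP (extU_mem_FP V hV) (extE_mem_FP V hV)))
/-- `kU ∈ FP`. [folklore] -/
theorem kU_mem_FP : kU c ∈ FP := comp_mem_FP (polyFn_mem_FP _) Boards.xF_mem_FP
/-- `goOnF ∈ FP`. [folklore] -/
theorem goOnF_mem_FP : goOnF c ∈ FP :=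
  comp_mem_FP ltLenF_mem_FP (fanoutFn_mem_FP (comp_mem_FP (cons_mem_FP true)
    (comp_mem_FP appF_mem_FP (fanoutFn_mem_FP jU_mem_FP jU_mem_FP))) (kU_mem_FP c))
/-- `oddF ∈ FP`. [folklore] -/
theorem oddF_mem_FP : oddF c ∈ FP :=
  comp_mem_FP ltLenF_mem_FP (fanoutFn_mem_FP
    (comp_mem_FP appF_mem_FP (fanoutFn_mem_FP jU_mem_FP jU_mem_FP)) (kU_mem_FP c))
/-- `finViewF ∈ FP`. [folklore] -/
theorem finViewF_mem_FP (hV : V.IsPolyTime) : finViewF V c ∈ FP :=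
  fanoutFn_mem_FP Boards.xF_mem_FP (fanoutFn_mem_FP (rF_mem_FP V)
    (iteFn_mem_FP (oddF_mem_FP c) (fanoutFn_mem_FP (extU_mem_FP V hV) (extE_mem_FP V hV))
      (fanoutFn_mem_FP (accU_mem_FP V hV) (accE_mem_FP V hV))))
/-- `verdF ∈ FP` (the verdict language is in `P`, `indicatorFn_mem_FP`). [folklore] -/
theorem verdF_mem_FP (hV : V.IsPolyTime) : verdF V c ∈ FP :=
  comp_mem_FP (indicatorFn_mem_FP hV.2) (finViewF_mem_FP V c hV)
/-- **The step function is in `FP`** for a polynomial-time verifier ("in probabilistic polynomial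
time we can run … `V`"). [cite: BellareGoldwasser1994, Lemma 4.3 (proof)] -/
theorem stepS_mem_FP (hV : V.IsPolyTime) : stepS V c ∈ FP :=
  iteFn_mem_FP (goOnF_mem_FP c) (comp_mem_FP (cons_mem_FP false) (qryF_mem_FP V hV))
    (comp_mem_FP (cons_mem_FP true) (verdF_mem_FP V c hV))

/-! #### Values on `z = ⟨w, enc ans⟩` -/

section Values

variable (w : List Bool) (ans : List (List Bool))

/-- The argument of the step function: `⟨w, ⟨1ʲ, encList ans⟩⟩`. [folklore] -/
theorem arg_eq : boolPair w (encMoves ans) = boolPair w (boolPair (ones ans.length) (encList ans)) := by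
  rw [Boards.encMoves_eq]

/-- Value of `Boards.xF`: `x`. [folklore] -/
@[simp] theorem xF_arg : Boards.xF (boolPair w (encMoves ans)) = fstF w := by simp [Boards.xF]
/-- Value of `tF`: `t`. [folklore] -/
@[simp] theorem tF_arg : tF (boolPair w (encMoves ans)) = sndF w := by simp [tF]
/-- Value of `jU`: `1ʲ`. [folklore] -/
@[simp] theorem jU_arg : jU (boolPair w (encMoves ans)) = ones ans.length := by simp [jU, arg_eq]
/-- Value of `ansE`: `encList ans`. [folklore] -/
@[simp] theorem ansE_arg : ansE (boolPair w (encMoves ans)) = encList ans := by simp [ansE, arg_eq]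
/-- Value of `rF`: the verifier's coins `r`. [folklore] -/
@[simp] theorem rF_arg : rF V (boolPair w (encMoves ans)) = rOf V w := by
  simp [rF, ellF, rOf, ones, tF, Boards.xF]
/-- Value of `sF`: the prover's coins `s`. [folklore] -/
@[simp] theorem sF_arg : sF V (boolPair w (encMoves ans)) = sOf V w := by
  simp [sF, ellF, sOf, ones, tF, Boards.xF]
/-- Value of `ctxF`: `⟨x, ⟨r, encList ans⟩⟩`. [folklore] -/
@[simp] theorem ctxF_arg :
    ctxF V (boolPair w (encMoves ans)) = boolPair (fstF w) (boolPair (rOf V w) (encList ans)) := by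
  simp [ctxF]
/-- Value of `kU`: `1^k`. [folklore] -/
@[simp] theorem kU_arg : kU c (boolPair w (encMoves ans)) = ones ((fstF w).length ^ c) := by
  simp [kU]

/-- **Value of the replay piece.** [folklore] -/
theorem pieceF_apply (x r : List Bool) (i : ℕ) :
    pieceF V (boolPair (boolPair x (boolPair r (encList ans))) (ones i)) =
      boolPair x (boolPair r (ans.getD i [] ++ List.replicate (V.msgLen.eval x.length) false)) := by
  simp only [pieceF, fanoutFn_apply, Function.comp_apply, fstF_boolPair, sndF_boolPair, nthF_zero,
    nthF_succ_boolPair, sndPow_succ_boolPair, sndPow_zero, appF_boolPair, nthItemFn_encList,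
    zerosFn_apply, GSRef.emU_apply]
  simp [ones]

/-- **The fold of the replay computes the replay model.** [folklore] -/
theorem foldAcc_pieceF (x r : List Bool) :
    ∀ i : ℕ, foldAcc (GSRef.replayOp V) (pieceF V) (boolPair x (boolPair r (encList ans))) 0 i [] =
      if i = 0 then [] else
        boolPair (ones (2 * i)) (encList (replayT V x r (V.msgLen.eval x.length) ans i))
  | 0 => rfl
  | i + 1 => by
    rw [foldAcc_succ', foldAcc_pieceF x r i, Nat.zero_add, pieceF_apply, if_neg (Nat.succ_ne_zero i)]
    split_ifs with hi
    · subst hi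
      rw [GSRef.replayOp_apply V (P := []) (by simp [ones]) (by simp),
        GSRef.take_append_replicate_eq_takeD]
      simp [replayT]
    · rw [GSRef.replayOp_apply V (P := replayT V x r (V.msgLen.eval x.length) ans i) (by simp) (by simp),
        GSRef.take_append_replicate_eq_takeD, length_replayT]
      simp only [replayT]
      congr 2

/-- **Value of the replay**: `⟨1^{2j}, encList T_j⟩` (`ε` for `j = 0`). [folklore] -/
theorem replayF_arg : replayF V (boolPair w (encMoves ans)) =
    if ans.length = 0 then [] else boolPair (ones (2 * ans.length)) (encList (curT V w ans)) := by
  rw [replayF, runFold_apply]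
  · rw [jU_arg, ctxF_arg, show (ones ans.length).length = ans.length by simp [ones], foldAcc_pieceF]
    rfl
  · rw [jU_arg, ctxF_arg, length_boolPair, length_boolPair]
    have := Com.length_le_length_encList ans
    simp only [ones, List.length_replicate]
    omega

/-- Value of `accU`: `1^{2j}`. [folklore] -/
@[simp] theorem accU_arg : accU V (boolPair w (encMoves ans)) = ones (2 * ans.length) := by
  rw [accU, Function.comp_apply, replayF_arg]
  split_ifs with h
  · simp [h, ones]
  · rw [fstF_boolPair]

/-- Value of `accE`: `encList T_j`. [folklore] -/
@[simp] theorem accE_arg : accE V (boolPair w (encMoves ans)) = encList (curT V w ans) := by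
  rw [accE, Function.comp_apply, replayF_arg]
  split_ifs with h
  · rw [curT, h]
    simp [replayT]
  · rw [sndF_boolPair]

/-- Value of `viewF`: the verifier's view of the reconstructed history. [folklore] -/
@[simp] theorem viewF_arg :
    viewF V (boolPair w (encMoves ans)) = IPVerifier.view (fstF w) (rOf V w) (curT V w ans) := by
  rw [IPVerifier.view, ← encMoves, Boards.encMoves_eq (curT V w ans), curT, length_replayT, ← curT]
  simp [viewF]

/-- Value of `msgNextF`: the verifier's next message. [folklore] -/
@[simp] theorem msgNextF_arg : msgNextF V (boolPair w (encMoves ans)) = nextA V w ans := by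
  rw [msgNextF, Function.comp_apply, fanoutFn_apply, xF_arg, viewF_arg, GSRef.msgF_apply]
  rfl

/-- The code of the extended history: `⟨1^{2j+1}, encList (T_j a)⟩ = enc (T_j a)`. [folklore] -/
theorem ext_arg : boolPair (extU V (boolPair w (encMoves ans))) (extE V (boolPair w (encMoves ans))) =
    encMoves (curT V w ans ++ [nextA V w ans]) := by
  rw [Boards.encMoves_eq (curT V w ans ++ _), List.length_append, List.length_singleton, curT,
    length_replayT, ← curT, Boards.encList_append, Boards.encList_singleton]
  simp [extU, extE, ones, List.replicate_succ]

/-- Value of `qryF`: the query `⟨x, ⟨s, enc (T_j a)⟩⟩`. [folklore] -/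
@[simp] theorem qryF_arg : qryF V (boolPair w (encMoves ans)) =
    boolPair (fstF w) (boolPair (sOf V w) (encMoves (curT V w ans ++ [nextA V w ans]))) := by
  rw [← ext_arg]
  simp [qryF]

/-- Value of the guard: `[2j + 1 < k]`. [folklore] -/
@[simp] theorem goOnF_arg :
    goOnF c (boolPair w (encMoves ans)) = [decide (2 * ans.length + 1 < (fstF w).length ^ c)] := by
  simp only [goOnF, Function.comp_apply, fanoutFn_apply, jU_arg, kU_arg, appF_boolPair, ltLenF_boolPair,
    List.length_cons, List.length_append]
  simp only [ones, List.length_replicate, List.cons.injEq, and_true]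
  rw [decide_eq_decide]
  omega

/-- Value of the parity test: `[2j < k]`. [folklore] -/
@[simp] theorem oddF_arg :
    oddF c (boolPair w (encMoves ans)) = [decide (2 * ans.length < (fstF w).length ^ c)] := by
  simp only [oddF, Function.comp_apply, fanoutFn_apply, jU_arg, kU_arg, appF_boolPair, ltLenF_boolPair,
    List.length_append]
  simp only [ones, List.length_replicate, List.cons.injEq, and_true]
  rw [decide_eq_decide]
  omega

/-- Value of `finViewF`: the final view (a last verifier message iff `k` is odd). [folklore] -/
@[simp] theorem finViewF_arg : finViewF V c (boolPair w (encMoves ans)) =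
    IPVerifier.view (fstF w) (rOf V w)
      (if 2 * ans.length < (fstF w).length ^ c then curT V w ans ++ [nextA V w ans] else curT V w ans) := by
  rw [finViewF, fanoutFn_apply, fanoutFn_apply, xF_arg, rF_arg]
  by_cases h : 2 * ans.length < (fstF w).length ^ c
  · rw [iteFn_apply_true (by rw [oddF_arg, decide_eq_true h]), fanoutFn_apply, ext_arg, if_pos h]
    rfl
  · rw [iteFn_apply_false (by rw [oddF_arg, decide_eq_false h]), fanoutFn_apply, accU_arg, accE_arg,
      if_neg h, IPVerifier.view, ← encMoves, Boards.encMoves_eq (curT V w ans), curT, length_replayT]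

/-- Value of `verdF`: the verdict bit. [folklore] -/
@[simp] theorem verdF_arg : verdF V c (boolPair w (encMoves ans)) =
    [V.verdict.boolIndicator (IPVerifier.view (fstF w) (rOf V w)
      (if 2 * ans.length < (fstF w).length ^ c then curT V w ans ++ [nextA V w ans] else curT V w ans))] := by
  rw [verdF, Function.comp_apply, finViewF_arg]
  rfl

/-- **The string map computes the step function of the outer algorithm.**
[cite: BellareGoldwasser1994, Lemma 4.3 (proof)] -/
theorem stepS_apply : stepS V c (boolPair w (encMoves ans)) = stepCode ((outerAlg V c).step w ans) := by
  show _ = stepCode (outerStep V c w ans)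
  by_cases h : 2 * ans.length + 1 < (fstF w).length ^ c
  · rw [stepS, iteFn_apply_true (by rw [goOnF_arg, decide_eq_true h]), outerStep, if_pos h,
      stepCode_inl, Function.comp_apply, qryF_arg]
  · rw [stepS, iteFn_apply_false (by rw [goOnF_arg, decide_eq_false h]), outerStep, if_neg h,
      stepCode_inr, Function.comp_apply, verdF_arg]

end Values

/-- **The outer algorithm is polynomial-time.** [cite: BellareGoldwasser1994, Lemma 4.3 (proof)] -/
theorem outerAlg_isPolyTime (hV : V.IsPolyTime) : (outerAlg V c).IsPolyTime encodingBoolBool := by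
  obtain ⟨p, Mx, h⟩ := stepS_mem_FP V c hV
  refine ⟨p, Mx, fun z => ?_⟩
  have hz := h (boolPair z.1 (encMoves z.2))
  rw [id, stepS_apply] at hz
  exact hz

/-! ### The run of the outer algorithm against a prover oracle -/

section Run

variable {V c}
variable (f : Oracle) (x t : List Bool)

/-- The `2i`-message prefix of the genuine interaction of `V` (coins `t↾ℓ`) with the competitive
prover `f` (coins `t⇂ℓ`). [folklore] -/
def hist (i : ℕ) : List (List Bool) :=
  V.transcriptAux x (t.take (V.coins.eval x.length))
    (competitiveStrategy f x (t.drop (V.coins.eval x.length))) (V.msgLen.eval x.length) true (2 * i) []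

/-- The prefix after `i` rounds has `2i` messages. [folklore] -/
@[simp] theorem length_hist (i : ℕ) : (hist f x t (V := V) i).length = 2 * i := by
  rw [hist, IPVerifier.length_transcriptAux, List.length_nil, Nat.zero_add]

/-- Every message of the prefix has length `msgLen |x|`. [folklore] -/
theorem length_eq_of_mem_hist (i : ℕ) {a : List Bool} (ha : a ∈ hist f x t (V := V) i) :
    a.length = V.msgLen.eval x.length :=
  V.length_eq_of_mem_transcriptAux x _ _ _ true (2 * i) [] (by simp) a ha

/-- Splitting an interaction after an even number of messages. [cite: AroraBarakCC2009, Def. 8.6] -/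
theorem transcriptAux_two_mul_add (V : IPVerifier) (x r : List Bool) (P : IPProver) (m i n : ℕ) :
    ∀ t₀ : List (List Bool), V.transcriptAux x r P m true (2 * i + n) t₀ =
      V.transcriptAux x r P m true n (V.transcriptAux x r P m true (2 * i) t₀) := by
  induction i with
  | zero => intro t₀; simp [IPVerifier.transcriptAux_zero_eq]
  | succ i ih =>
    intro t₀
    rw [show 2 * (i + 1) + n = 2 * i + n + 1 + 1 by ring, show 2 * (i + 1) = 2 * i + 1 + 1 by ring,
      IPVerifier.transcriptAux_succ_true, IPVerifier.transcriptAux_succ_false,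
      IPVerifier.transcriptAux_succ_true, IPVerifier.transcriptAux_succ_false]
    exact ih _

/-- One more round of the genuine interaction. [cite: AroraBarakCC2009, Def. 8.6] -/
theorem hist_succ (i : ℕ) : hist f x t (V := V) (i + 1) =
    hist f x t (V := V) i ++ [V.vmsg x (V.msgLen.eval x.length) (t.take (V.coins.eval x.length)) (hist f x t (V := V) i),
      (competitiveStrategy f x (t.drop (V.coins.eval x.length))
        (hist f x t (V := V) i ++ [V.vmsg x (V.msgLen.eval x.length) (t.take (V.coins.eval x.length))
          (hist f x t (V := V) i)])).takeD (V.msgLen.eval x.length) false] := by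
  rw [hist, show 2 * (i + 1) = 2 * i + (1 + 1) by ring, transcriptAux_two_mul_add, ← hist,
    IPVerifier.transcriptAux_succ_true, IPVerifier.transcriptAux_succ_false,
    IPVerifier.transcriptAux_zero_eq, List.append_assoc]
  rfl

/-- The whole interaction: `k = 2 (k/2)` or `k = 2 (k/2) + 1` messages. [cite: AroraBarakCC2009, Def. 8.6] -/
theorem transcript_eq_hist (k : ℕ) :
    V.transcript k x (t.take (V.coins.eval x.length)) (competitiveStrategy f x (t.drop (V.coins.eval x.length))) =
      if 2 * (k / 2) < k then
        hist f x t (V := V) (k / 2) ++ [V.vmsg x (V.msgLen.eval x.length) (t.take (V.coins.eval x.length))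
          (hist f x t (V := V) (k / 2))]
      else hist f x t (V := V) (k / 2) := by
  split_ifs with h
  · have hk : k = 2 * (k / 2) + 1 := by omega
    rw [IPVerifier.transcript]
    conv_lhs => rw [hk]
    rw [transcriptAux_two_mul_add, ← hist, IPVerifier.transcriptAux_succ_true,
      IPVerifier.transcriptAux_zero_eq]
  · have hk : k = 2 * (k / 2) := by omega
    rw [IPVerifier.transcript]
    conv_lhs => rw [hk]
    rfl

variable (V c)

/-- **The transcript invariant of the outer algorithm**: after `i ≤ k/2` rounds against the prover
oracle `f`, the history reconstructed from the answers received IS the `2i`-message prefix of the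
interaction of `V` with `competitiveStrategy f x s`. [cite: BellareGoldwasser1994, Lemma 4.3 (proof)] -/
theorem curT_trans : ∀ {i : ℕ}, 2 * i ≤ x.length ^ c →
    curT V (boolPair x t) (trans (outerAlg V c) f (boolPair x t) i) = hist f x t (V := V) i
  | 0, _ => by simp [curT, replayT, hist, IPVerifier.transcriptAux_zero_eq]
  | i + 1, hi => by
    have ih := curT_trans (i := i) (by omega)
    have hlt : 2 * i + 1 < x.length ^ c := by omega
    have hstep : (outerAlg V c).step (boolPair x t) (trans (outerAlg V c) f (boolPair x t) i) =
        Sum.inl (boolPair x (boolPair (t.drop (V.coins.eval x.length))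
          (encMoves (hist f x t (V := V) i ++ [V.vmsg x (V.msgLen.eval x.length)
            (t.take (V.coins.eval x.length)) (hist f x t (V := V) i)])))) := by
      show outerStep V c _ _ = _
      rw [outerStep, length_trans, fstF_boolPair, if_pos hlt, nextA, ih]
      simp [sOf, rOf, mOf]
    rw [curT, length_trans, replayT, trans_succ, qryOf_eq_of_step_eq hstep] at *
    rw [replayT_congr V _ _ _ (ans' := trans (outerAlg V c) f (boolPair x t) i) (i := i)
        (fun i' hi' => getD_append_of_lt _ _ _ (by rw [length_trans]; exact hi')),
      fstF_boolPair] at *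
    rw [ih, hist_succ]
    have hget := getD_append_length (trans (outerAlg V c) f (boolPair x t) i)
      (f (boolPair x (boolPair (List.drop (eval x.length V.coins) t)
        (encMoves (hist f x t (V := V) i ++ [V.vmsg x (V.msgLen.eval x.length)
          (t.take (V.coins.eval x.length)) (hist f x t (V := V) i)]))))) []
    rw [length_trans] at hget
    rw [hget]
    simp [rOf, mOf, competitiveStrategy]

/-- **The run of the outer algorithm**: against the prover oracle `f`, within any budget of more
than `k/2` rounds, it outputs the verdict of `V` (coins `r = t↾ℓ`) on its interaction with
`competitiveStrategy f x s` (`s = t⇂ℓ`). [cite: BellareGoldwasser1994, Lemma 4.3 (proof)] -/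
theorem run_outerAlg {n : ℕ} (hn : x.length ^ c / 2 < n) :
    (outerAlg V c).run f n (boolPair x t) =
      some (V.verdict.boolIndicator (IPVerifier.view x (t.take (V.coins.eval x.length))
        (V.transcript (x.length ^ c) x (t.take (V.coins.eval x.length))
          (competitiveStrategy f x (t.drop (V.coins.eval x.length)))))) := by
  set k := x.length ^ c with hk
  rw [run_eq_some_iff]
  refine ⟨k / 2, hn, fun i hi => ?_, ?_⟩
  · change ∃ y, outerStep V c _ _ = Sum.inl y
    rw [outerStep, length_trans, fstF_boolPair, ← hk, if_pos (by omega)]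
    exact ⟨_, rfl⟩
  · show outerStep V c _ _ = _
    rw [outerStep, length_trans, fstF_boolPair, ← hk, if_neg (by omega), nextA,
      curT_trans V c f x t (by rw [← hk]; omega), transcript_eq_hist, fstF_boolPair]
    simp only [rOf, mOf, fstF_boolPair, sndF_boolPair]

/-- **The queries of the outer algorithm are the prover views** `⟨x, ⟨s, enc (a₁ … a_{2i+1})⟩⟩`,
`2i + 1 < k`. [cite: BellareGoldwasser1994, Lemma 4.3 (proof)] -/
theorem exists_of_mem_queries_outerAlg {n : ℕ} {y : List Bool}
    (hy : y ∈ (outerAlg V c).queries f n (boolPair x t)) :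
    ∃ i, 2 * i + 1 < x.length ^ c ∧ y = boolPair x (boolPair (t.drop (V.coins.eval x.length))
      (encMoves (hist f x t (V := V) i ++ [V.vmsg x (V.msgLen.eval x.length)
        (t.take (V.coins.eval x.length)) (hist f x t (V := V) i)]))) := by
  obtain ⟨i, -, hall, rfl⟩ := exists_of_mem_queries _ _ n _ y hy
  obtain ⟨y', hy'⟩ := hall i le_rfl
  have hstep : (outerAlg V c).step (boolPair x t) (trans (outerAlg V c) f (boolPair x t) i) =
      outerStep V c (boolPair x t) (trans (outerAlg V c) f (boolPair x t) i) := rfl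
  have hlt : 2 * i + 1 < x.length ^ c := by
    by_contra hge
    rw [hstep, outerStep, length_trans, fstF_boolPair, if_neg hge] at hy'
    cases hy'
  refine ⟨i, hlt, ?_⟩
  have hq := qryOf_eq_of_step_eq hy'
  rw [hstep, outerStep, length_trans, fstF_boolPair, if_pos hlt, nextA, curT_trans V c f x t (by omega)] at hy'
  rw [hq, ← Sum.inl.inj hy']
  simp [sOf, rOf, mOf]

/-- **The resource polynomial of the outer algorithm** (rounds `k/2 + 1 ≤ n^c + 1`; queries of length
`≤ 4n + 6 + 4n^c + 2 n^c msgLen(n)`, `n = |w|`). [folklore] -/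
def qOut : Polynomial ℕ := X ^ c + 4 * X + 7 + 4 * X ^ c + 2 * X ^ c * V.msgLen

/-- **Query lengths**: every query on `w = ⟨x, t⟩` has length `≤ qOut |w|`. [folklore] -/
theorem length_le_of_mem_queries {n : ℕ} {y : List Bool} (hy : y ∈ (outerAlg V c).queries f n (boolPair x t)) :
    y.length ≤ (qOut V c).eval (boolPair x t).length := by
  obtain ⟨i, hi, rfl⟩ := exists_of_mem_queries_outerAlg V c f x t hy
  have hmsgs : ∀ a ∈ hist f x t (V := V) i ++ [V.vmsg x (V.msgLen.eval x.length)
      (t.take (V.coins.eval x.length)) (hist f x t (V := V) i)], a.length ≤ V.msgLen.eval x.length := by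
    intro a ha
    rcases List.mem_append.1 ha with ha | ha
    · exact (length_eq_of_mem_hist f x t i ha).le
    · rw [List.mem_singleton.1 ha, IPVerifier.length_vmsg]
  -- a coded list of `n` items of length `≤ B` has length `≤ n (2B + 2)`
  have hcode : ∀ (l : List (List Bool)) (B : ℕ), (∀ a ∈ l, a.length ≤ B) →
      (encList l).length ≤ l.length * (2 * B + 2) := by
    intro l B h
    induction l with
    | nil => simp
    | cons a l ih =>
      rw [encList_cons, length_boolPair, List.length_cons]
      have ha := h a (by simp)
      have hl := ih fun b hb => h b (by simp [hb])
      nlinarith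
  have henc := hcode _ _ hmsgs
  rw [List.length_append, List.length_singleton, length_hist] at henc
  have hx : x.length ≤ (boolPair x t).length := by rw [length_boolPair]; omega
  have ht : t.length ≤ (boolPair x t).length := by rw [length_boolPair]; omega
  have hkc : x.length ^ c ≤ (boolPair x t).length ^ c := Nat.pow_le_pow_left hx c
  have hmn : V.msgLen.eval x.length ≤ V.msgLen.eval (boolPair x t).length := TM2Iter.eval_mono _ hx
  have hdrop : (t.drop (V.coins.eval x.length)).length ≤ t.length := by
    rw [List.length_drop]; exact Nat.sub_le _ _
  have h1 : (2 * i + 1) * (2 * V.msgLen.eval x.length + 2) ≤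
      x.length ^ c * (2 * V.msgLen.eval (boolPair x t).length + 2) := Nat.mul_le_mul hi.le (by omega)
  have h2 : x.length ^ c * (2 * V.msgLen.eval (boolPair x t).length + 2) ≤
      (boolPair x t).length ^ c * (2 * V.msgLen.eval (boolPair x t).length + 2) :=
    Nat.mul_le_mul_right _ hkc
  rw [Boards.encMoves_eq, length_boolPair, length_boolPair, length_boolPair, List.length_append,
    List.length_singleton, length_hist]
  simp only [qOut, eval_add, eval_mul, eval_pow, eval_X, eval_ofNat, ones, List.length_replicate]
  linarith [henc, h1, h2, hkc, hdrop, ht, hx, hi]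

/-- The round budget suffices: `k/2 < qOut |w|`. [folklore] -/
theorem half_lt_qOut : x.length ^ c / 2 < (qOut V c).eval (boolPair x t).length := by
  have hx : x.length ≤ (boolPair x t).length := by rw [length_boolPair]; omega
  have hkc : x.length ^ c ≤ (boolPair x t).length ^ c := Nat.pow_le_pow_left hx c
  simp only [qOut, eval_add, eval_mul, eval_pow, eval_X, eval_ofNat]
  omega

end Run

/-! ### Averaging over the prover's coins -/

/-- Coin strings of length `a + b` as pairs (first `a` coins, last `b` coins). [folklore] -/
def splitVec (a b : ℕ) : List.Vector Bool (a + b) ≃ List.Vector Bool a × List.Vector Bool b where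
  toFun w := (⟨w.toList.take a, by simp⟩, ⟨w.toList.drop a, by simp⟩)
  invFun p := p.1 ++ p.2
  left_inv w := List.Vector.eq _ _ (by
    rw [List.Vector.toList_append]
    exact List.take_append_drop a w.toList)
  right_inv p := by
    obtain ⟨u, v⟩ := p
    have hu : u.toList.length = a := u.toList_length
    refine Prod.ext (List.Vector.eq _ _ ?_) (List.Vector.eq _ _ ?_)
    · show List.take a (u ++ v).toList = u.toList
      rw [List.Vector.toList_append, List.take_left' hu]
    · show List.drop a (u ++ v).toList = v.toList
      rw [List.Vector.toList_append, List.drop_left' hu]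

/-- Counting fibrewise over the LAST `b` coins: `cnt (a+b) {w | Q (w↾a) (w⇂a)} = Σ_v cnt a {u | Q u v}`.
[cite: AroraBarakCC2009, §7.1 (independent coin blocks)] -/
theorem cnt_split_suffix (a b : ℕ) (Q : List Bool → List Bool → Prop) :
    cnt (a + b) {w | Q (w.take a) (w.drop a)} = ∑ v : List.Vector Bool b, cnt a {u | Q u v.toList} := by
  classical
  unfold cnt
  simp only [Finset.card_eq_sum_ones, Finset.sum_filter, Set.mem_setOf_eq]
  rw [Fintype.sum_equiv (splitVec a b)
      (fun w : List.Vector Bool (a + b) => if Q (w.toList.take a) (w.toList.drop a) then 1 else 0)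
      (fun p : List.Vector Bool a × List.Vector Bool b => if Q p.1.toList p.2.toList then 1 else 0)
      (fun w => rfl), Fintype.sum_prod_type_right]

/-- **Averaging**: if every section `{u | Q u v}` (`|v| = b`) of an event on `{0,1}^{a+b}` has
probability `≤ θ` over `u ∈ {0,1}^a`, the event has probability `≤ θ`. (Soundness of the decider:
for EACH value of the prover's coins the verifier faces some fixed prover.)
[cite: BellareGoldwasser1994, Lemma 4.3 (proof, last sentence)] -/
theorem uniformProb_split_le {a b : ℕ} {Q : List Bool → List Bool → Prop} {θ : ℝ}
    (h : ∀ v : List Bool, v.length = b → uniformProb a {u | Q u v} ≤ θ) :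
    uniformProb (a + b) {w | Q (w.take a) (w.drop a)} ≤ θ := by
  classical
  have hsum : uniformProb (a + b) {w | Q (w.take a) (w.drop a)} =
      (∑ v : List.Vector Bool b, uniformProb a {u | Q u v.toList}) / 2 ^ b := by
    rw [uniformProb_eq_cnt_div, cnt_split_suffix, Nat.cast_sum, pow_add]
    simp only [uniformProb_eq_cnt_div]
    rw [← Finset.sum_div, div_div]
  rw [hsum, div_le_iff₀ (by positivity)]
  calc ∑ v : List.Vector Bool b, uniformProb a {u | Q u v.toList}
      ≤ ∑ _v : List.Vector Bool b, θ := Finset.sum_le_sum fun v _ => h v.toList v.toList_length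
    _ = θ * 2 ^ b := by
      rw [Finset.sum_const, Finset.card_univ, card_vector, Fintype.card_bool, nsmul_eq_mul, mul_comm]
      norm_cast

end CompIPDecider

/-! ### The theorem -/

open CompIPDecider in
/-- **Bellare–Goldwasser 1994, Lemma 4.3: `compIP ⊆ frIP`** — every language with a competitive
interactive proof system has a decider (a function-restricted interactive proof, `mem_frIP_iff`).
The decider `D = ⟨C, coins + q, ·⟩` runs `V` and the honest prover's oracle machine on one uniform
string `t = R_V R_P`, forwarding the prover's oracle queries to its own oracle
(`OracleAlg.exists_polyTime_subroutine` applied to `CompIPDecider.outerAlg` and the `FP^L` machine of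
the honest prover); with oracle `L` this is the honest interaction (completeness), with any oracle
`A` an interaction of `V` with the prover `competitiveStrategy (subAnswer R qR [] A) x s` for each `s`
(soundness, averaged over `s` by `CompIPDecider.uniformProb_split_le`).
[cite: BellareGoldwasser1994, Lemma 4.3] -/
theorem compIP_subset_frIP_holds : compIP_subset_frIP := by
  intro L hL
  obtain ⟨V, c, M, q, hV, hM, hcomp, hsound⟩ := hL
  obtain ⟨R, hR, qR, hRspec⟩ := hM
  obtain ⟨C, hC, qC, hCspec⟩ :=
    OracleAlg.exists_polyTime_subroutine (outerAlg_isPolyTime V c hV) hR (qOut V c) qR []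
  rw [mem_frIP_iff]
  -- the run of the composite decider on `⟨x, t⟩`, `|t| = coins |x| + q |x|`, under any oracle `O`
  have hrun : ∀ (O : Oracle) (x t : List Bool), t.length = V.coins.eval x.length + q.eval x.length →
      C.run O ((qC.comp (2 * X + 2 + (V.coins + q))).eval x.length) (boolPair x t) =
        some (V.verdict.boolIndicator (IPVerifier.view x (t.take (V.coins.eval x.length))
          (V.transcript (x.length ^ c) x (t.take (V.coins.eval x.length))
            (competitiveStrategy (OracleAlg.subAnswer R qR [] O) x (t.drop (V.coins.eval x.length)))))) := by
    intro O x t ht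
    have hlen : (qC.comp (2 * X + 2 + (V.coins + q))).eval x.length = qC.eval (boolPair x t).length := by
      simp [eval_comp, length_boolPair, ht]
    rw [hlen]
    exact (hCspec O (boolPair x t) _ (run_outerAlg V c _ x t (half_lt_qOut V c x t))
      (fun y hy => length_le_of_mem_queries V c _ x t hy)).1
  -- hence its acceptance probability is that of `V` against `competitiveStrategy f_O x s`, over `t = r s`
  have hprob : ∀ (O : Oracle) (x : List Bool),
      (⟨C, V.coins + q, qC.comp (2 * X + 2 + (V.coins + q))⟩ : ProbOracleMachine).acceptProbOn O x =
        uniformProb (V.coins.eval x.length + q.eval x.length)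
          {t | V.Accepts (x.length ^ c) x (t.take (V.coins.eval x.length))
            (competitiveStrategy (OracleAlg.subAnswer R qR [] O) x (t.drop (V.coins.eval x.length)))} := by
    intro O x
    rw [OracleAdversary.acceptProbOn_eq]
    simp only [eval_add]
    rw [uniformProb_eq_cnt_div, uniformProb_eq_cnt_div, cnt_congr]
    intro t ht
    simp only [Set.mem_setOf_eq]
    rw [hrun O x t ht, Option.some.injEq, IPVerifier.Accepts]
    exact (Set.mem_iff_boolIndicator _ _).symm
  refine ⟨⟨C, V.coins + q, qC.comp (2 * X + 2 + (V.coins + q))⟩, hC, fun x hx => ?_, fun A x hx => ?_⟩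
  · -- completeness: under oracle `L` the subroutine IS the honest prover `M`
    have hf : OracleAlg.subAnswer R qR [] (Oracle.ofLanguage L) = M :=
      funext fun u => OracleAlg.subAnswer_of_run_eq_some R qR [] _ (hRspec u).1
    rw [hprob, hf]
    exact hcomp x hx
  · -- soundness: for each `s` the verifier faces the prover `competitiveStrategy f_A x s`
    rw [hprob]
    exact uniformProb_split_le
      (Q := fun u v => V.Accepts (x.length ^ c) x u
        (competitiveStrategy (OracleAlg.subAnswer R qR [] (Oracle.ofLanguage A)) x v))
      fun v _ => hsound x hx _

end Literature.Computability.Complexity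

end
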